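import Mathlib
import Literature.LinearAlgebra.Matrix.IntegerElementaryMatrices
import HarnessLib

/-!
# Smith normal form of a non-singular `2 × 2` integer matrix: `A = P · g·diag(1, q) · Q`,
# `P, Q ∈ GL₂(ℤ)`

Topic `LinearAlgebra/Matrix`; theorems only (no definition, no named fact, no instance). For a
`2 × 2` matrix `A` over `ℤ` with `det A ≠ 0` there are integer matrices `P, Q` of unit
determinant, an integer `g ≠ 0` and a natural number `q ≥ 1` with

  `A = P * (g • diagonal ![1, q]) * Q`  (`exists_smith_normal_form_fin_two_int`),

i.e. the elementary divisors of `A` are `g ∣ g q`. The tree's `IntegerElementaryMatrices` brings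
`A` to SOME diagonal form `diag(a, b)` by transvections (Adkins–Weintraub Ch. 5 Rem. 3.4, only the
diagonal shape); the divisibility `a ∣ b` of the Smith form (Adkins–Weintraub Ch. 5 Thm. 3.1;
Newman, *Integral Matrices*, II.15) is obtained here for `2 × 2` matrices by the classical Bézout
step `U diag(a, b) V = diag(gcd, ab/gcd)` with explicit unimodular `U, V`
(`bezout_mul_diagonal_mul`), and the sign of the second divisor is absorbed into `Q`. Mathlib's
`Submodule.smithNormalForm` (stacked bases over a PID) likewise gives no divisibility chain.
Used for the Eichler orders of `M₂(ℚ)` (`NumberTheory/Automorphic/EichlerOrdersMatrixRat`): a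
rational `k ∈ GL₂(ℚ)` is `λ γ diag(1, q) γ'` with `γ, γ' ∈ GL₂(ℤ)`.

## References

* W. A. Adkins, S. H. Weintraub, *Algebra. An Approach via Module Theory*, GTM 136 (1992),
  Ch. 5, Thm. 3.1 and Remark 3.4 [AdkinsWeintraub1992].
-/

open Matrix

namespace Literature.LinearAlgebra.Matrix

/-- **The Bézout step.** For integers `a = g a'`, `b = g b'` with `x a' + y b' = 1`, the
unimodular matrices `U = (x y; -b' a')`, `V = (1 0; 1 1)(1 -yb'; 0 1)` satisfy
`U · diag(a, b) · V = diag(g, g a' b')`. [folklore] -/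
theorem bezout_mul_diagonal_mul {a b g a' b' x y : ℤ} (ha : a = g * a') (hb : b = g * b')
    (hxy : x * a' + y * b' = 1) :
    !![x, y; -b', a'] * !![a, 0; 0, b] * !![1, -(y * b'); 1, 1 - y * b'] =
      !![g, 0; 0, g * a' * b'] := by
  ext i j
  fin_cases i <;> fin_cases j
  · simp [Matrix.mul_apply, Fin.sum_univ_two, ha, hb]
    linear_combination g * hxy
  · simp [Matrix.mul_apply, Fin.sum_univ_two, ha, hb]
    linear_combination (-(g * y * b')) * hxy
  · simp [Matrix.mul_apply, Fin.sum_univ_two, ha, hb]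
    ring
  · simp [Matrix.mul_apply, Fin.sum_univ_two, ha, hb]
    ring

/-- `diagonal ![a, b] = (a 0; 0 b)`. [folklore] -/
theorem diagonal_fin_two_eq (a b : ℤ) : diagonal ![a, b] = !![a, 0; 0, b] := by
  ext i j
  fin_cases i <;> fin_cases j <;> rfl

/-- `det (x y; -b' a') = x a' + y b'`. [folklore] -/
theorem det_bezoutU (a' b' x y : ℤ) : (!![x, y; -b', a']).det = x * a' + y * b' := by
  rw [det_fin_two_of]; ring

/-- `det ((1 0; 1 1)(1 -yb'; 0 1)) = 1`, entrywise form. [folklore] -/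
theorem det_bezoutV (y b' : ℤ) : (!![(1 : ℤ), -(y * b'); 1, 1 - y * b']).det = 1 := by
  rw [det_fin_two_of]; ring

/-- **Smith normal form of a non-singular `2 × 2` integer matrix.** If `det A ≠ 0` there are
integer matrices `P, Q` with unit determinant, `g ∈ ℤ ∖ 0` and `q ∈ ℕ`, `q ≥ 1`, such that
`A = P · (g • diag(1, q)) · Q`. [cite: AdkinsWeintraub1992, Ch. 5, Thm. 3.1 and Remark 3.4] -/
theorem exists_smith_normal_form_fin_two_int (A : Matrix (Fin 2) (Fin 2) ℤ) (hA : A.det ≠ 0) :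
    ∃ (P Q : Matrix (Fin 2) (Fin 2) ℤ) (g : ℤ) (q : ℕ), IsUnit P.det ∧ IsUnit Q.det ∧ 0 < q ∧
      g ≠ 0 ∧ A = P * (g • diagonal ![(1 : ℤ), (q : ℤ)]) * Q := by
  -- a diagonal form by transvections
  obtain ⟨L, L', D, hD⟩ := exists_list_transvec_mul_diagonal_mul_list_transvec_int A
  set PL : Matrix (Fin 2) (Fin 2) ℤ := (L.map TransvectionStruct.toMatrix).prod with hPL
  set QL : Matrix (Fin 2) (Fin 2) ℤ := (L'.map TransvectionStruct.toMatrix).prod with hQL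
  have hPLdet : PL.det = 1 := TransvectionStruct.det_toMatrix_prod L
  have hQLdet : QL.det = 1 := TransvectionStruct.det_toMatrix_prod L'
  set a : ℤ := D 0 with ha
  set b : ℤ := D 1 with hb
  have hDiag : diagonal D = !![a, 0; 0, b] := by
    rw [← diagonal_fin_two_eq]
    congr 1; funext i; fin_cases i <;> rfl
  have hab : a * b ≠ 0 := by
    have h := congrArg Matrix.det hD
    rw [det_mul, det_mul, hPLdet, hQLdet, one_mul, mul_one, hDiag, det_fin_two_of,
      mul_zero, sub_zero] at h
    rw [← h]; exact hA
  have ha0 : a ≠ 0 := left_ne_zero_of_mul hab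
  have hb0 : b ≠ 0 := right_ne_zero_of_mul hab
  -- Bézout
  set g : ℤ := (Int.gcd a b : ℤ) with hg
  have hg0 : g ≠ 0 := by
    rw [hg]
    exact_mod_cast fun h => ha0 (Int.gcd_eq_zero_iff.mp h).1
  obtain ⟨a', ha'⟩ : g ∣ a := Int.gcd_dvd_left a b
  obtain ⟨b', hb'⟩ : g ∣ b := Int.gcd_dvd_right a b
  set x : ℤ := Int.gcdA a b with hx
  set y : ℤ := Int.gcdB a b with hy
  have hxy : x * a' + y * b' = 1 := by
    have h : g = a * x + b * y := Int.gcd_eq_gcd_ab a b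
    rw [ha', hb'] at h
    have h2 : g * (x * a' + y * b') = g * 1 := by
      rw [mul_one]
      linear_combination -h
    exact mul_left_cancel₀ hg0 h2
  set U : Matrix (Fin 2) (Fin 2) ℤ := !![x, y; -b', a'] with hU
  set V : Matrix (Fin 2) (Fin 2) ℤ := !![1, -(y * b'); 1, 1 - y * b'] with hV
  have hUdet : U.det = 1 := by rw [hU, det_bezoutU, hxy]
  have hVdet : V.det = 1 := by rw [hV, det_bezoutV]
  have hUV : U * !![a, 0; 0, b] * V = !![g, 0; 0, g * a' * b'] :=
    bezout_mul_diagonal_mul ha' hb' hxy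
  have hUunit : IsUnit U.det := by rw [hUdet]; exact isUnit_one
  have hVunit : IsUnit V.det := by rw [hVdet]; exact isUnit_one
  -- `diag(a, b) = U⁻¹ diag(g, g a' b') V⁻¹`
  have hDiag' : !![a, 0; 0, b] = U⁻¹ * !![g, 0; 0, g * a' * b'] * V⁻¹ := by
    rw [← hUV]
    rw [show U⁻¹ * (U * !![a, 0; 0, b] * V) * V⁻¹ =
        (U⁻¹ * U) * !![a, 0; 0, b] * (V * V⁻¹) by simp only [Matrix.mul_assoc]]
    rw [nonsing_inv_mul _ hUunit, mul_nonsing_inv _ hVunit, Matrix.one_mul, Matrix.mul_one]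
  -- signs: `g a' b' = g · s · q`, `s = ±1`
  set c : ℤ := a' * b' with hc
  have hc0 : c ≠ 0 := by
    rw [hc]
    refine mul_ne_zero ?_ ?_
    · rintro rfl; apply ha0; rw [ha', mul_zero]
    · rintro rfl; apply hb0; rw [hb', mul_zero]
  set q : ℕ := c.natAbs with hq
  set s : ℤ := c.sign with hs
  have hcsq : c = s * q := by rw [hs, hq, Int.sign_mul_natAbs]
  have hs1 : IsUnit s := by
    rw [Int.isUnit_iff_natAbs_eq, hs, Int.natAbs_sign_of_ne_zero hc0]
  have hdiag2 : !![g, 0; 0, g * a' * b'] =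
      (g • diagonal ![(1 : ℤ), (q : ℤ)]) * diagonal ![(1 : ℤ), s] := by
    rw [mul_assoc, ← hc, hcsq]
    ext i j
    fin_cases i <;> fin_cases j <;> simp [Matrix.mul_apply, diagonal]
    ring
  refine ⟨PL * U⁻¹, diagonal ![(1 : ℤ), s] * V⁻¹ * QL, g, q, ?_, ?_, ?_, hg0, ?_⟩
  · rw [det_mul, hPLdet, det_nonsing_inv, hUdet]; simp
  · rw [det_mul, det_mul, hQLdet, det_nonsing_inv, hVdet, det_diagonal, Fin.prod_univ_two]
    simpa using hs1
  · rw [hq]; exact Int.natAbs_pos.mpr hc0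
  · rw [hD, hDiag, hDiag', hdiag2]
    simp only [Matrix.mul_assoc]

end Literature.LinearAlgebra.Matrix
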